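import Summits.AtomisticToContinuum.BoseEinsteinCondensation.Theorems.BECThomsonPrincipleGDTransferSeededGradingDefs
import Summits.AtomisticToContinuum.BoseEinsteinCondensation.Theorems.BECThomsonPrincipleGDTransferSeededWitnessDefs
import Summits.AtomisticToContinuum.BoseEinsteinCondensation.Theorems.BECThomsonPrincipleGDTransferSeededCountLaw
import Summits.AtomisticToContinuum.BoseEinsteinCondensation.Theorems.BECThomsonPrincipleGDTransferSeededIvtGlue
import Summits.AtomisticToContinuum.BoseEinsteinCondensation.Theorems.BECThomsonPrincipleGDTransferSeededNearMinPhase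
import Summits.AtomisticToContinuum.BoseEinsteinCondensation.Theorems.BECThomsonPrincipleGDTransferSeededPlainFormBridge
import Summits.AtomisticToContinuum.BoseEinsteinCondensation.Theorems.BECThomsonPrincipleGDTransferChordVariationForms

/-!
# Route `BECThomsonPrinciple`, crux `GDTransfer` (stmt-AtomisticToContinuum-9482), line `seeded-continuity` —
# fixed-`N` seed programme: POINTWISE CAT EXCLUSION (registered sub-goal `pointwiseCatExclusion`)

Supports (does not close) stmt-AtomisticToContinuum-9482.

**Statement** (`pointwiseCatExclusion : SectorBlockAlgebra → SharpCutSplitting → PointwiseCatExclusion`, the lead's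
sub-goal of the fixed-`N` seed programme typed in `…SeededGradingDefs`): for an admissible finite continuous profile and
band parameters `θ, β` there is `N₀` such that at every FIXED `(N, L)`, `N ≥ N₀`, `L > 0`, some threshold `τ < 1/2` and
slack `δ > 0` — chosen AFTER `(N, L)` — make every `δ`-near-minimiser `Ψ` satisfy
`¬(τ ≤ P_Ψ(n̂₀ < θN) ∧ τ ≤ P_Ψ(n̂₀ ≥ (1−β)N))`.

**Proof.** Work with the symmetrised profile `u r = v|r|` (same energies; bounded on `ℝ`).  Bound the interaction on
configuration space by `C = N²·C_per` (`exists_bound_periodizedPotential`), take the phase-stability slack `δ_s` of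
`seeded_nearMinimisers_phase_close` at tolerance `1`, and put `τ = 1/2 − κ`, `κ = min(1/8, δ_r/(16(C+1)))` with
`ofReal δ_r ≤ δ_s`, `δ = δ_s/8`, `N₀ = ⌈4/(1−β−θ)⌉₊ + 1`.  If a `δ`-near-minimiser `Ψ` had both tails `≥ τ`, cut it at
`j = ⌈θN⌉₊ + 2` (`SectorBlockAlgebra`, `SharpCutSplitting`): the four sectors around the cut lie in the middle band, whose
mass is `≤ 1 − 2τ = 2κ`, so `𝓔(A) + 𝓔(B) ≤ E₀ + δ + 2κC`, while `𝓔(A) ≥ E₀‖A‖²`, `𝓔(B) ≥ E₀‖B‖²`, `‖A‖² + ‖B‖² = 1`,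
`‖A‖², ‖B‖² ≥ τ ≥ 3/8`; hence the normalised blocks `Â, B̂` are `δ_s`-near-minimisers, so `∫|Â − cB̂|² ≤ 1` for a phase
`c` — but `Â ⊥ B̂` gives `∫|Â − cB̂|² = 2`.

References: ReedSimonIV1978 §XIII.12 (nondegenerate ground states ⇒ near-minimiser stability); LSSY2005 §1.2.
-/

noncomputable section

open MeasureTheory Filter
open scoped ENNReal NNReal ComplexConjugate

namespace Summit.AtomisticToContinuum.BoseEinsteinCondensation.Cruxes.GDTransfer.Seeded

open Literature.MathematicalPhysics.QuantumManyBody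
open Literature.MathematicalPhysics.QuantumManyBody.BoseGas
open Summit.AtomisticToContinuum.BoseEinsteinCondensation.Theorems.GaussianDominationCan.Negative (modeProj)
open Summit.AtomisticToContinuum.BoseEinsteinCondensation.Cruxes.GDTransfer.DysonDressedWitness
  (IsDirection mass eform eform_trialState)
open Summit.AtomisticToContinuum.BoseEinsteinCondensation.Cruxes.GDTransfer.DysonDressedWitness.ChordVariation
  (mass_ne_top_of_continuous mass_smul eform_smul e0_mul_mass_le_eform)
open Summit.AtomisticToContinuum.BoseEinsteinCondensation.Theorems (exists_bound_of_continuous_finiteRange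
  exists_bound_periodizedPotential)

variable {m : ℕ}


/-! ## Bookkeeping lemmas -/

/-- A bound `C_per` on the periodised profile bounds the interaction on configuration space by `N·(N·C_per)`. -/
theorem periodicInteraction_le_of_periodized_le {u : ℝ → ℝ≥0∞} {L : ℝ} {C : ℝ≥0}
    (hC : ∀ x, periodizedPotential u L x ≤ C) (X : Config (m + 1)) :
    periodicInteraction u L X ≤ ((((m + 1 : ℕ) : ℝ≥0) * (((m + 1 : ℕ) : ℝ≥0) * C) : ℝ≥0) : ℝ≥0∞) := by
  unfold periodicInteraction
  calc ∑ i : Fin (m + 1), ∑ j ∈ Finset.univ.filter (fun j => i < j), periodizedPotential u L (X i - X j)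
      ≤ ∑ _i : Fin (m + 1), ∑ _j : Fin (m + 1), (C : ℝ≥0∞) := by
        refine Finset.sum_le_sum fun i _ => ?_
        exact (Finset.sum_le_sum_of_subset (Finset.filter_subset _ _)).trans
          (Finset.sum_le_sum fun j _ => hC _)
    _ = ((((m + 1 : ℕ) : ℝ≥0) * (((m + 1 : ℕ) : ℝ≥0) * C) : ℝ≥0) : ℝ≥0∞) := by
        simp only [Finset.sum_const, Finset.card_univ, Fintype.card_fin, nsmul_eq_mul]
        push_cast
        ring

/-- Law masses of a periodic trial state over pairwise disjoint sets of counts add up to at most `1`. -/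
theorem lawMass_add_add_le_one {L : ℝ} (hL : 0 < L) (Ψ : PeriodicTrialState (m + 1) L)
    (p q r : ℕ → Prop) [DecidablePred p] [DecidablePred q] [DecidablePred r]
    (hpq : ∀ i, p i → ¬ q i) (hpr : ∀ i, p i → ¬ r i) (hqr : ∀ i, q i → ¬ r i) :
    lawMass m L p Ψ.ψ + lawMass m L q Ψ.ψ + lawMass m L r Ψ.ψ ≤ 1 := by
  classical
  have h1 := (stub_countLaw.1 m L hL Ψ).1
  unfold lawMass
  set U := (Finset.univ : Finset (Finset (Fin (m + 1))))
  have dpq : Disjoint (U.filter fun S => p S.card) (U.filter fun S => q S.card) :=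
    Finset.disjoint_filter.2 fun S _ hS => hpq _ hS
  have dpr : Disjoint (U.filter fun S => p S.card) (U.filter fun S => r S.card) :=
    Finset.disjoint_filter.2 fun S _ hS => hpr _ hS
  have dqr : Disjoint (U.filter fun S => q S.card) (U.filter fun S => r S.card) :=
    Finset.disjoint_filter.2 fun S _ hS => hqr _ hS
  rw [← Finset.sum_union dpq, ← Finset.sum_union (Finset.disjoint_union_left.2 ⟨dpr, dqr⟩), ← h1]
  exact Finset.sum_le_sum_of_subset (Finset.subset_univ _)

/-- A law mass over a smaller set of counts is smaller. -/
theorem lawMass_mono {L : ℝ} (ψ : Config (m + 1) → ℂ) {p q : ℕ → Prop} [DecidablePred p] [DecidablePred q]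
    (h : ∀ i, p i → q i) : lawMass m L p ψ ≤ lawMass m L q ψ := by
  unfold lawMass
  refine Finset.sum_le_sum_of_subset fun S hS => ?_
  simp only [Finset.mem_filter, Finset.mem_univ, true_and] at hS ⊢
  exact h _ hS

/-- The energy of the normalised block `ofFun A …` is `‖A‖⁻² 𝓔(A)`. -/
theorem periodicEnergy_ofFun (u : ℝ → ℝ≥0∞) {L : ℝ} {A : Config (m + 1) → ℂ} (hA : IsDirection m L A)
    (h0 : mass L A ≠ 0) (htop : mass L A ≠ ⊤) :
    periodicEnergy u (PeriodicTrialState.ofFun A hA.contDiff hA.periodic hA.symm h0 htop) =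
      (mass L A)⁻¹ * eform u L A := by
  set a : ℂ := ((Real.sqrt (mass L A).toReal)⁻¹ : ℂ) with ha_def
  have hΨ : (PeriodicTrialState.ofFun A hA.contDiff hA.periodic hA.symm h0 htop).ψ = fun X => a * A X := rfl
  have hIpos : 0 < (mass L A).toReal := ENNReal.toReal_pos h0 htop
  have ha : (‖a‖₊ : ℝ≥0∞) ^ 2 = (mass L A)⁻¹ := by
    rw [coe_nnnorm_sq_eq_ofReal, ha_def, norm_inv, Complex.norm_real,
      Real.norm_of_nonneg (Real.sqrt_nonneg _), inv_pow, Real.sq_sqrt hIpos.le,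
      ENNReal.ofReal_inv_of_pos hIpos, ENNReal.ofReal_toReal htop]
  rw [← eform_trialState, hΨ, eform_smul u a hA.contDiff, ha]

/-- Two ORTHOGONAL unit-mass continuous functions are at squared `L²`-distance `2` after any phase:
`∫|f − c g|² = 2` for `‖c‖ = 1`, `∫|f|² = ∫|g|² = 1`, `∫ conj(f) g = 0`. -/
theorem mass_sub_phase_mul_eq_two {L : ℝ} {f g : Config (m + 1) → ℂ} (hf : Continuous f) (hg : Continuous g)
    (hf1 : mass L f = 1) (hg1 : mass L g = 1) (horth : ∫ X in cellN (m + 1) L, conj (f X) * g X = 0)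
    {c : ℂ} (hc : ‖c‖ = 1) :
    (∫⁻ X in cellN (m + 1) L, (‖f X - c * g X‖₊ : ℝ≥0∞) ^ 2) = ENNReal.ofReal 2 := by
  have hcg : Continuous fun X => c * g X := continuous_const.mul hg
  have hfun : (fun X => f X - c * g X) = fun X => f X + (((-1 : ℝ) : ℂ)) * (c * g X) := by
    funext X; push_cast; ring
  have hmass : mass L (fun X => c * g X) = 1 := by
    rw [mass_smul, hg1, mul_one, ← ENNReal.coe_one, ← ENNReal.coe_pow, ENNReal.coe_inj, ← NNReal.coe_inj]
    simp [hc]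
  have hinner : (∫ X in cellN (m + 1) L, conj (c * g X) * f X) = 0 := by
    have h1 : (fun X => conj (c * g X) * f X) = fun X => conj c * (conj (g X) * f X) := by
      funext X; simp only [map_mul]; ring
    rw [h1, integral_const_mul, PlainCost.inner_conj_symm g f, horth, map_zero, mul_zero]
  have key := PlainCost.mass_line_toReal (L := L) hcg hf (-1)
  rw [hinner, Complex.zero_re, mul_zero, PlainCost.mass_toReal_eq L hf, PlainCost.mass_toReal_eq L hcg] at key
  have hf1' : (∫ X in cellN (m + 1) L, conj (f X) * f X).re = 1 := by
    rw [← PlainCost.mass_toReal_eq L hf, hf1, ENNReal.toReal_one]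
  have hg1' : (∫ X in cellN (m + 1) L, conj (c * g X) * (c * g X)).re = 1 := by
    rw [← PlainCost.mass_toReal_eq L hcg, hmass, ENNReal.toReal_one]
  rw [hf1', hg1'] at key
  have hne : mass L (fun X => f X + (((-1 : ℝ) : ℂ)) * (c * g X)) ≠ ⊤ :=
    mass_ne_top_of_continuous (hf.add (continuous_const.mul hcg))
  have hval : (mass L (fun X => f X + (((-1 : ℝ) : ℂ)) * (c * g X))).toReal = 2 := by rw [key]; ring
  show mass L (fun X => f X - c * g X) = ENNReal.ofReal 2
  rw [hfun, ← hval, ENNReal.ofReal_toReal hne]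

/-! ## The pointwise exclusion for a profile bounded on `ℝ` -/

/-- **Pointwise cat exclusion for a profile bounded on all of `ℝ`** (the symmetrised profile of the registered
statement): the core of the argument. -/
theorem pointwiseCatExclusion_of_bounded (hSA : SectorBlockAlgebra) (hSC : SharpCutSplitting) {u : ℝ → ℝ≥0∞}
    (hu : IsRepulsiveFiniteRange u) (hfc : IsFiniteContinuous u) {M : ℝ≥0} (huM : ∀ r, u r ≤ M)
    {θ β : ℝ} (hθ : 0 < θ) (hβ : 0 < β) (hθβ : θ + β < 1) :
    ∃ N₀ : ℕ, ∀ m : ℕ, N₀ ≤ m + 1 → ∀ L : ℝ, 0 < L →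
      ∃ τ : ℝ, 0 < τ ∧ τ < 1 / 2 ∧ ∃ δ : ℝ≥0∞, 0 < δ ∧ ∀ Ψ : PeriodicTrialState (m + 1) L,
        periodicEnergy u Ψ ≤ periodicGroundStateEnergy u (m + 1) L + δ →
        ¬ (ENNReal.ofReal τ ≤ loMass m L θ Ψ.ψ ∧ ENNReal.ofReal τ ≤ hiMass m L β Ψ.ψ) := by
  obtain ⟨hmeas, R₀, hR₀⟩ := hu
  have hgap : 0 < 1 - β - θ := by linarith
  refine ⟨⌈4 / (1 - β - θ)⌉₊ + 1, fun m hm L hL => ?_⟩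
  -- `N = m + 1` is large: `θN + 4 ≤ (1 − β)N`
  have hN : θ * (m + 1) + 4 ≤ (1 - β) * (m + 1) := by
    have h1 : (4 / (1 - β - θ) : ℝ) ≤ ⌈4 / (1 - β - θ)⌉₊ := Nat.le_ceil _
    have h2 : ((⌈4 / (1 - β - θ)⌉₊ + 1 : ℕ) : ℝ) ≤ ((m + 1 : ℕ) : ℝ) := by exact_mod_cast hm
    push_cast at h2
    have h3 : 4 / (1 - β - θ) ≤ (m : ℝ) + 1 := by linarith
    rw [div_le_iff₀ hgap] at h3
    nlinarith
  -- the interaction bound `C`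
  obtain ⟨Cper, hCper⟩ := exists_bound_periodizedPotential hL huM hR₀
  set C : ℝ≥0 := ((m + 1 : ℕ) : ℝ≥0) * (((m + 1 : ℕ) : ℝ≥0) * Cper) with hCdef
  have hW : ∀ X : Config (m + 1), periodicInteraction u L X ≤ C := fun X =>
    periodicInteraction_le_of_periodized_le hCper X
  -- phase stability at tolerance `1`
  obtain ⟨δs, hδs0, hδs⟩ := seeded_nearMinimisers_phase_close u hmeas R₀ hR₀ M huM m L hL 1 one_pos
  obtain ⟨δr, hδr0, hδr⟩ : ∃ δr : ℝ, 0 < δr ∧ ENNReal.ofReal δr ≤ δs := by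
    obtain ⟨q, _, hq1, hq2⟩ := ENNReal.lt_iff_exists_real_btwn.1 hδs0
    exact ⟨q, ENNReal.ofReal_pos.1 hq1, hq2.le⟩
  -- the threshold
  set κ : ℝ := min (1 / 8) (δr / (16 * ((C : ℝ) + 1))) with hκ
  have hC0 : (0 : ℝ) ≤ C := C.coe_nonneg
  have hκ0 : 0 < κ := lt_min (by norm_num) (by positivity)
  have hκ8 : κ ≤ 1 / 8 := min_le_left _ _
  have hκC : 2 * κ * C ≤ δr / 8 := by
    have h1 : κ ≤ δr / (16 * ((C : ℝ) + 1)) := min_le_right _ _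
    have h2 : κ * (16 * ((C : ℝ) + 1)) ≤ δr := by rwa [le_div_iff₀ (by positivity)] at h1
    nlinarith
  refine ⟨1 / 2 - κ, by linarith, by linarith, δs / 8, ?_, fun Ψ hΨ hcat => ?_⟩
  · exact ENNReal.div_pos hδs0.ne' (by norm_num)
  obtain ⟨hlo, hhi⟩ := hcat
  have hτ0 : (0 : ℝ) < 1 / 2 - κ := by linarith
  -- the cut `j = ⌈θN⌉₊ + 2`
  set j : ℕ := ⌈θ * (m + 1)⌉₊ + 2 with hj
  have hjlo : θ * (m + 1) ≤ (j : ℝ) - 2 := by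
    rw [hj]; push_cast; linarith [Nat.le_ceil (θ * (m + 1))]
  have hjhi : (j : ℝ) + 1 < (1 - β) * (m + 1) := by
    rw [hj]; push_cast
    have := Nat.ceil_lt_add_one (by positivity : (0 : ℝ) ≤ θ * (m + 1))
    linarith
  -- the blocks
  set A := sectorBlock m L (fun i => i < j) Ψ.ψ with hAdef
  set B := sectorBlock m L (fun i => ¬ i < j) Ψ.ψ with hBdef
  obtain ⟨hAdir, hAmass, _, hAB⟩ := hSA m L hL (fun i => i < j) Ψ
  obtain ⟨hBdir, hBmass, _, _⟩ := hSA m L hL (fun i => ¬ i < j) Ψ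
  have hsplit := hSC u ⟨hmeas, R₀, hR₀⟩ hfc m L hL C hW Ψ j
  rw [← hAdef] at hAdir hAmass hAB hsplit
  rw [← hBdef] at hBdir hBmass hAB hsplit
  -- masses: `τ ≤ ‖A‖²`, `τ ≤ ‖B‖²`, `‖A‖² + ‖B‖² = 1`, four-sector mass `≤ 2κ`
  have hτA : ENNReal.ofReal (1 / 2 - κ) ≤ mass L A := by
    rw [hAmass]
    refine hlo.trans (lawMass_mono _ fun i hi => ?_)
    have : (i : ℝ) < j := by linarith
    exact_mod_cast this
  have hτB : ENNReal.ofReal (1 / 2 - κ) ≤ mass L B := by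
    rw [hBmass]
    refine hhi.trans (lawMass_mono _ fun i hi => ?_)
    have : (j : ℝ) < i := by linarith
    have : j < i := by exact_mod_cast this
    omega
  have hAB1 : mass L A + mass L B = 1 := by
    rw [hAmass, hBmass, lawMass_add_lawMass_not, (stub_countLaw.1 m L hL Ψ).1]
  have hm4 : lawMass m L (fun i => j ≤ i + 2 ∧ i ≤ j + 1) Ψ.ψ ≤ ENNReal.ofReal (2 * κ) := by
    have h3 := lawMass_add_add_le_one hL Ψ (fun i => j ≤ i + 2 ∧ i ≤ j + 1)
      (fun i => (i : ℝ) < θ * (m + 1)) (fun i => (1 - β) * (m + 1) ≤ (i : ℝ))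
      (fun i hi hlo' => by
        have : (j : ℝ) ≤ i + 2 := by exact_mod_cast hi.1
        linarith)
      (fun i hi hhi' => by
        have : (i : ℝ) ≤ j + 1 := by exact_mod_cast hi.2
        linarith)
      (fun i hlo' hhi' => by
        have : (0 : ℝ) < m + 1 := by positivity
        nlinarith)
    have hlo' : ENNReal.ofReal (1 / 2 - κ) ≤ loMass m L θ Ψ.ψ := hlo
    have hhi' : ENNReal.ofReal (1 / 2 - κ) ≤ hiMass m L β Ψ.ψ := hhi
    unfold loMass at hlo'
    unfold hiMass at hhi'
    have h4 : lawMass m L (fun i => j ≤ i + 2 ∧ i ≤ j + 1) Ψ.ψ + ENNReal.ofReal (1 / 2 - κ) +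
        ENNReal.ofReal (1 / 2 - κ) ≤ 1 :=
      (add_le_add (add_le_add le_rfl hlo') hhi').trans h3
    have h5 : ENNReal.ofReal (1 / 2 - κ) + ENNReal.ofReal (1 / 2 - κ) = ENNReal.ofReal (1 - 2 * κ) := by
      rw [← ENNReal.ofReal_add hτ0.le hτ0.le]; ring_nf
    have hfin : ENNReal.ofReal (1 - 2 * κ) ≠ ⊤ := ENNReal.ofReal_ne_top
    rw [add_assoc, h5] at h4
    have h6 : lawMass m L (fun i => j ≤ i + 2 ∧ i ≤ j + 1) Ψ.ψ ≤ 1 - ENNReal.ofReal (1 - 2 * κ) :=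
      ENNReal.le_sub_of_add_le_right hfin h4
    refine h6.trans ?_
    rw [← ENNReal.ofReal_one, ← ENNReal.ofReal_sub _ (by linarith)]
    exact ENNReal.ofReal_le_ofReal (by linarith)
  -- energies: `𝓔(A) ≤ (E₀ + δ_s)‖A‖²` and likewise for `B`
  set E₀ := periodicGroundStateEnergy u (m + 1) L with hE₀
  have hE₀top : E₀ ≠ ⊤ := periodicGroundStateEnergy_ne_top_of_bounded hmeas hR₀ huM m hL
  have hmassA_top : mass L A ≠ ⊤ := mass_ne_top_of_continuous hAdir.contDiff.continuous
  have hmassB_top : mass L B ≠ ⊤ := mass_ne_top_of_continuous hBdir.contDiff.continuous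
  have hmassA0 : mass L A ≠ 0 := fun h => by
    rw [h] at hτA; exact absurd (le_antisymm hτA bot_le) (ENNReal.ofReal_pos.2 hτ0).ne'
  have hmassB0 : mass L B ≠ 0 := fun h => by
    rw [h] at hτB; exact absurd (le_antisymm hτB bot_le) (ENNReal.ofReal_pos.2 hτ0).ne'
  have herr : δs / 8 + (C : ℝ≥0∞) * lawMass m L (fun i => j ≤ i + 2 ∧ i ≤ j + 1) Ψ.ψ ≤
      δs * ENNReal.ofReal (1 / 2 - κ) := by
    have h1 : (C : ℝ≥0∞) * lawMass m L (fun i => j ≤ i + 2 ∧ i ≤ j + 1) Ψ.ψ ≤ δs / 8 := by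
      calc (C : ℝ≥0∞) * lawMass m L (fun i => j ≤ i + 2 ∧ i ≤ j + 1) Ψ.ψ
          ≤ (C : ℝ≥0∞) * ENNReal.ofReal (2 * κ) := by gcongr
        _ = ENNReal.ofReal (2 * κ * C) := by
            rw [ENNReal.ofReal_mul' hC0, ENNReal.ofReal_coe_nnreal, mul_comm]
        _ ≤ ENNReal.ofReal (δr / 8) := ENNReal.ofReal_le_ofReal hκC
        _ = ENNReal.ofReal δr / 8 := by
            rw [ENNReal.ofReal_div_of_pos (by norm_num)]; norm_num
        _ ≤ δs / 8 := by gcongr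
    have h2 : (1 : ℝ≥0∞) / 4 ≤ ENNReal.ofReal (1 / 2 - κ) := by
      rw [← ENNReal.ofReal_one, ← ENNReal.ofReal_ofNat, ← ENNReal.ofReal_div_of_pos (by norm_num)]
      exact ENNReal.ofReal_le_ofReal (by linarith)
    calc δs / 8 + (C : ℝ≥0∞) * lawMass m L (fun i => j ≤ i + 2 ∧ i ≤ j + 1) Ψ.ψ
        ≤ δs / 8 + δs / 8 := add_le_add le_rfl h1
      _ = δs * (1 / 4) := by
          rw [← two_mul, ENNReal.div_eq_inv_mul, ← mul_assoc, mul_comm (2 * 8⁻¹) δs]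
          congr 1
          rw [one_div, show (8 : ℝ≥0∞) = 2 * 4 by norm_num, ENNReal.mul_inv (Or.inl two_ne_zero)
            (Or.inl ENNReal.ofNat_ne_top), ← mul_assoc, ENNReal.mul_inv_cancel two_ne_zero
            ENNReal.ofNat_ne_top, one_mul]
      _ ≤ δs * ENNReal.ofReal (1 / 2 - κ) := by gcongr
  have hsum : eform u L A + eform u L B ≤ E₀ * mass L A + E₀ * mass L B +
      (δs / 8 + (C : ℝ≥0∞) * lawMass m L (fun i => j ≤ i + 2 ∧ i ≤ j + 1) Ψ.ψ) := by
    calc eform u L A + eform u L B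
        ≤ periodicEnergy u Ψ + (C : ℝ≥0∞) * lawMass m L (fun i => j ≤ i + 2 ∧ i ≤ j + 1) Ψ.ψ := hsplit
      _ ≤ E₀ + δs / 8 + (C : ℝ≥0∞) * lawMass m L (fun i => j ≤ i + 2 ∧ i ≤ j + 1) Ψ.ψ := by gcongr
      _ = E₀ * mass L A + E₀ * mass L B +
          (δs / 8 + (C : ℝ≥0∞) * lawMass m L (fun i => j ≤ i + 2 ∧ i ≤ j + 1) Ψ.ψ) := by
          rw [← mul_add, hAB1, mul_one, add_assoc]
  have heA : eform u L A ≤ (E₀ + δs) * mass L A := by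
    have h1 : eform u L A + E₀ * mass L B ≤ E₀ * mass L A +
        (δs / 8 + (C : ℝ≥0∞) * lawMass m L (fun i => j ≤ i + 2 ∧ i ≤ j + 1) Ψ.ψ) + E₀ * mass L B := by
      calc eform u L A + E₀ * mass L B ≤ eform u L A + eform u L B :=
            add_le_add le_rfl (e0_mul_mass_le_eform u hBdir)
        _ ≤ _ := hsum
        _ = _ := by ring
    have h2 := ENNReal.le_of_add_le_add_right (ENNReal.mul_ne_top hE₀top hmassB_top) h1
    calc eform u L A ≤ E₀ * mass L A + δs * ENNReal.ofReal (1 / 2 - κ) := h2.trans (add_le_add le_rfl herr)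
      _ ≤ E₀ * mass L A + δs * mass L A := by gcongr
      _ = (E₀ + δs) * mass L A := by ring
  have heB : eform u L B ≤ (E₀ + δs) * mass L B := by
    have h1 : eform u L B + E₀ * mass L A ≤ E₀ * mass L B +
        (δs / 8 + (C : ℝ≥0∞) * lawMass m L (fun i => j ≤ i + 2 ∧ i ≤ j + 1) Ψ.ψ) + E₀ * mass L A := by
      calc eform u L B + E₀ * mass L A ≤ eform u L A + eform u L B := by
            rw [add_comm]; exact add_le_add (e0_mul_mass_le_eform u hAdir) le_rfl
        _ ≤ _ := hsum
        _ = _ := by ring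
    have h2 := ENNReal.le_of_add_le_add_right (ENNReal.mul_ne_top hE₀top hmassA_top) h1
    calc eform u L B ≤ E₀ * mass L B + δs * ENNReal.ofReal (1 / 2 - κ) := h2.trans (add_le_add le_rfl herr)
      _ ≤ E₀ * mass L B + δs * mass L B := by gcongr
      _ = (E₀ + δs) * mass L B := by ring
  -- the normalised blocks are `δ_s`-near-minimisers
  set PA := PeriodicTrialState.ofFun A hAdir.contDiff hAdir.periodic hAdir.symm hmassA0 hmassA_top with hPA
  set PB := PeriodicTrialState.ofFun B hBdir.contDiff hBdir.periodic hBdir.symm hmassB0 hmassB_top with hPB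
  have hPAnear : periodicEnergy u PA ≤ E₀ + δs := by
    rw [hPA, periodicEnergy_ofFun u hAdir hmassA0 hmassA_top]
    calc (mass L A)⁻¹ * eform u L A ≤ (mass L A)⁻¹ * ((E₀ + δs) * mass L A) := by gcongr
      _ = E₀ + δs := by
          rw [mul_comm (E₀ + δs), ← mul_assoc, ENNReal.inv_mul_cancel hmassA0 hmassA_top, one_mul]
  have hPBnear : periodicEnergy u PB ≤ E₀ + δs := by
    rw [hPB, periodicEnergy_ofFun u hBdir hmassB0 hmassB_top]
    calc (mass L B)⁻¹ * eform u L B ≤ (mass L B)⁻¹ * ((E₀ + δs) * mass L B) := by gcongr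
      _ = E₀ + δs := by
          rw [mul_comm (E₀ + δs), ← mul_assoc, ENNReal.inv_mul_cancel hmassB0 hmassB_top, one_mul]
  obtain ⟨c, hc1, hclose⟩ := hδs PA PB hPAnear hPBnear
  -- but they are orthogonal unit vectors: squared distance `2 ≤ 1`, absurd
  set a : ℂ := ((Real.sqrt (mass L A).toReal)⁻¹ : ℂ) with ha_def
  set b : ℂ := ((Real.sqrt (mass L B).toReal)⁻¹ : ℂ) with hb_def
  have hPAψ : PA.ψ = fun X => a * A X := rfl
  have hPBψ : PB.ψ = fun X => b * B X := rfl
  have horth : (∫ X in cellN (m + 1) L, conj (PA.ψ X) * PB.ψ X) = 0 := by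
    rw [hPAψ, hPBψ]
    have h1 : (fun X => conj (a * A X) * (b * B X)) = fun X => (conj a * b) * (conj (A X) * B X) := by
      funext X; simp only [map_mul]; ring
    simp only [h1]
    rw [integral_const_mul, hAB, mul_zero]
  have htwo := mass_sub_phase_mul_eq_two PA.contDiff.continuous PB.contDiff.continuous PA.norm_eq PB.norm_eq
    horth hc1
  rw [htwo, one_pow] at hclose
  have h21 : (2 : ℝ) ≤ 1 := (ENNReal.ofReal_le_ofReal_iff zero_le_one).1 hclose
  linarith

/-! ## The registered sub-goal -/

/-- **Registered sub-goal `pointwiseCatExclusion` of the fixed-`N` seed programme** (line `seeded-continuity`, crux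
`GDTransfer`, stmt-AtomisticToContinuum-9482): at each fixed `(N, L)` some `τ_{N,L} < 1/2` excludes balanced cats among the
near-minimisers of an admissible finite continuous profile — the sharp cut in the `n̂₀`-grading + phase stability of
near-minimisers (nondegenerate torus ground state).  [cite: ReedSimonIV1978, §XIII.12] -/
theorem pointwiseCatExclusion : SectorBlockAlgebra → SharpCutSplitting → PointwiseCatExclusion := by
  intro hSA hSC v hv hfc θ β hθ hβ hθβ
  obtain ⟨hmeas, R₀, hR₀⟩ := hv
  obtain ⟨hfin, hcont⟩ := hfc
  -- the symmetrised profile `u r = v |r|`: same energies, bounded on all of `ℝ`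
  set u : ℝ → ℝ≥0∞ := fun r => v |r| with hu
  have hu_meas : Measurable u := hmeas.comp continuous_abs.measurable
  have hu_fin : ∀ r, u r ≠ ⊤ := fun r => hfin _
  have hu_cont : Continuous fun x : Space => (u ‖x‖).toReal := by
    simp only [hu, abs_norm]
    exact hcont
  have huR : ∀ r, R₀ < r → u r = 0 := fun r hr => hR₀ _ (hr.trans_le (le_abs_self r))
  obtain ⟨M, hM⟩ := exists_bound_of_continuous_finiteRange hu_fin hu_cont huR
  have huM : ∀ r, u r ≤ M := fun r => by
    have h := hM (EuclideanSpace.single 0 r)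
    have hn : ‖EuclideanSpace.single (0 : Fin 3) r‖ = |r| := by
      rw [EuclideanSpace.norm_eq]
      simp [Real.sqrt_sq_eq_abs]
    rw [hn] at h
    simpa only [hu, abs_abs] using h
  have hE' : ∀ (m : ℕ) {L : ℝ} (Φ : PeriodicTrialState (m + 1) L), periodicEnergy u Φ = periodicEnergy v Φ := by
    intro m L Φ
    unfold periodicEnergy periodicInteraction periodizedPotential
    simp only [hu, abs_norm]
  have hE₀ : ∀ (m : ℕ) (L : ℝ), periodicGroundStateEnergy u (m + 1) L = periodicGroundStateEnergy v (m + 1) L :=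
    fun m L => by
    unfold periodicGroundStateEnergy
    exact iInf_congr fun Φ => hE' m Φ
  obtain ⟨N₀, hN₀⟩ := pointwiseCatExclusion_of_bounded hSA hSC ⟨hu_meas, R₀, huR⟩ ⟨hu_fin, hu_cont⟩ huM hθ hβ hθβ
  refine ⟨N₀, fun m hm L hL => ?_⟩
  obtain ⟨τ, hτ0, hτ, δ, hδ, hΨ⟩ := hN₀ m hm L hL
  refine ⟨τ, hτ0, hτ, δ, hδ, fun Ψ hΨ' => hΨ Ψ ?_⟩
  rw [hE' m Ψ, hE₀ m L]
  exact hΨ'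

end Summit.AtomisticToContinuum.BoseEinsteinCondensation.Cruxes.GDTransfer.Seeded

end
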